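import Literature.Analysis.FluidPDE.AncientMildWeak
import Literature.Analysis.FluidPDE.NSBoundedMildOseenDuhamel
import Literature.Analysis.FluidPDE.KNSSRemark61
import Literature.Analysis.FluidPDE.OseenKernelLineIntegrals
import Literature.Analysis.UnboundedOperators.HeatExtensionDecay
import Literature.Analysis.UnboundedOperators.HeatKernelBoundedData
import HarnessLib

/-!
# KNSS 2009, Theorem 6.2, Liouville step: the planar half from Theorem 5.1 on the plane

Analysis/FluidPDE proofs file (theorems only) for the first ("horizontal") half of the
Liouville step of the proof of Koch–Nadirashvili–Seregin–Šverák, Acta Math. 203 (2009) =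
arXiv:0709.3599, Theorem 6.2 (named facts `KNSS2009_typeI_rate_liouville` of
`KNSSTypeIRateCore` and `KNSS2009_typeI_rate_liouville_horizontal` of `KNSSTypeIRateLiouville`;
p. 13: "Applying Theorem 5.1 and Remark 6.1 to the field `(w₁, w₃)`, we conclude that
`(w₁, w₃)` must vanish identically"). The data are a field `W : ℝ → ℝ³ → ℝ³` jointly continuous
and bounded on `(−∞, 0) × ℝ³` with weakly divergence-free slices, satisfying the Oseen integral
equation `W(t) = e^{(t−s)Δ} W(s) − B¹_s(W, W)(t)` pointwise for all `s < t < 0`, independent of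
`x₂` (Lean coordinate `1`), with `√(−t)‖W(t, x)‖ ≤ C`. This file proves everything in that half
**except the descent to the plane**, which is isolated as an explicit hypothesis:

* `isBoundedAncientMildSolution_of_oseen` (any dimension, viscosity `ν > 0`): an Oseen-mild
  bounded continuous ancient field with weakly divergence-free slices is a bounded ancient mild
  solution in the tree's duality form (`IsBoundedAncientMildSolution`: the representation
  formula tested against a divergence-free test field `φ` gives the two-time identity — the free
  term by the symmetry of the caloric pairing, `integral_inner_heatExtension_comm_of_bound`, the
  Duhamel term by `integral_inner_oseenDuhamel_eq_neg_intervalIntegral`), hence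
  (`isBoundedWeakNSSolutionOn_of_oseen`) a bounded weak solution on `ℝⁿ × (−∞, 0)` in KNSS's
  sense (`IsBoundedAncientMildSolution.isBoundedWeakNSSolutionOn`, KNSS §4 (i)–(ii): mild
  solutions are weak solutions);
* `inner_integral_oseenKernel_sub_eq_zero_of_planar_const`, `planar_eq_zero_of_planar_const`
  (**Remark 6.1 for the field `β(t) + W₁e₁`**): if the planar part of `W` is constant in space,
  `W(τ, y) = β(τ) + W₁(τ, y)e₁`, then the planar components of the inner integral
  `∫ K(σ, x − y)[W, W] dy` of the Duhamel term vanish (`∫ K[β, β] dy = 0` by oddness,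
  `KNSSRemark61`; the planar part of `∫ K[β, W₁e₁] dy` and all of `∫ K[W₁e₁, W] dy` by the line
  integrals of `OseenKernelLineIntegrals`), so `β(t) = e^{(t−s)Δ}β(s) − 0 = β(s)` for all
  `s < t`, and `√(−s)‖β‖ ≤ C`, `s → −∞`, force `β = 0`;
* `planar_const_of_ae_const`: if the trace `V(t, y) = (W₀, W₂)(t, (y₀, 0, y₁))` of the planar
  part on the plane `x₁ = 0` is a.e. equal to a constant for a.e. `t < 0` (the conclusion of
  Theorem 5.1 for `V`), then by continuity the planar part of `W` is constant in space at every
  `t < 0` (`Measure.eq_of_ae_eq`, `Measure.eqOn_open_of_ae_eq`, and the invariance in `x₁`);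
* `KNSS2009_typeI_rate_liouville_horizontal_of_weak_planar` (**assembly**): Theorem 5.1 as
  printed (`KNSS2009_liouville_planar`) implies the horizontal half for every `W` whose planar
  trace `V` is a bounded weak solution on `ℝ² × (−∞, 0)`.

The remaining input — that `V` is a bounded weak solution on the plane (Oseen-mild ⇒ weak on
`ℝ³` by `isBoundedWeakNSSolutionOn_of_oseen`, then descent of bounded weak solutions independent
of one coordinate) — is proved in the sibling file `KNSSTypeIRateLiouvilleDescent`.

## References

* G. Koch, N. Nadirashvili, G. Seregin, V. Šverák, Acta Math. 203 (2009) 83–105 =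
  arXiv:0709.3599 (arXiv pages): proof of Theorem 6.2, p. 13; Theorem 5.1, p. 9; Remark 6.1,
  p. 11; §4 (i)–(ii), p. 8. [KochNadirashviliSereginSverak2009]
* P. G. Lemarié-Rieusset, *The Navier–Stokes problem in the 21st century* (2016), Thm. 6.1
  ((6.12) ⇒ (6.11): Oseen solutions are very weak solutions). [LemarieRieusset2016]
-/

noncomputable section

open MeasureTheory Set Function Filter TopologicalSpace WithLp
open _root_.Topology
open scoped RealInnerProductSpace

namespace Literature.Analysis.FluidPDE

/-! ### Oseen-mild ⇒ duality-form mild ⇒ bounded weak (any dimension) -/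

section Mild

variable {E : Type*} [NormedAddCommGroup E] [InnerProductSpace ℝ E] [FiniteDimensional ℝ E]
  [MeasurableSpace E] [BorelSpace E]

/-- **An Oseen-mild bounded continuous ancient field is a bounded ancient mild solution in
duality form** (Lemarié-Rieusset 2016, Thm. 6.1, (6.12) ⇒ (6.11); KNSS 2009, §4 (i)). Let
`ν > 0` and let `W : ℝ → E → E` be jointly continuous and bounded on `(−∞, 0) × E`, with weakly
divergence-free slices, and `W(t) = e^{ν(t−s)Δ} W(s) − B^ν_s(W, W)(t)` pointwise for all
`s < t < 0`. Then `IsBoundedAncientMildSolution ν W`: testing the representation formula against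
a divergence-free test field `φ`, the free term is `∫⟪W(s), e^{ν(t−s)Δ}φ⟫`
(`integral_inner_heatExtension_comm_of_bound`) and the Duhamel term is
`−∫ₛᵗ∫⟪W, (W·∇)e^{ν(t−τ)Δ}φ⟫` (`integral_inner_oseenDuhamel_eq_neg_intervalIntegral`). [cite: LemarieRieusset2016, Thm. 6.1 ((6.12) ⇒ (6.11))] -/
theorem isBoundedAncientMildSolution_of_oseen {ν : ℝ} (hν : 0 < ν) {W : ℝ → E → E}
    (hcont : ContinuousOn (uncurry W) (Iio 0 ×ˢ univ))
    (hbdd : ∃ K : ℝ, ∀ t < 0, ∀ x, ‖W t x‖ ≤ K)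
    (hdiv : ∀ t < 0, IsWeaklyDivFree (W t))
    (hmild : ∀ s t : ℝ, s < t → t < 0 → ∀ x,
      W t x = UnboundedOperators.heatExtension (W s) (ν * (t - s)) x - oseenDuhamel ν s W W t x) :
    IsBoundedAncientMildSolution ν W := by
  obtain ⟨K, hK⟩ := hbdd
  have hK0 : 0 ≤ K := (norm_nonneg _).trans (hK (-1) (by norm_num) 0)
  have hWc : ∀ τ < 0, Continuous (W τ) := fun τ hτ =>
    hcont.comp_continuous (f := fun x : E => (τ, x)) (by fun_prop) fun x => ⟨hτ, mem_univ _⟩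
  refine ⟨⟨hdiv, fun s t hst ht φ hφ hφdiv => ?_⟩, ⟨K, fun t ht x => hK t ht x⟩⟩
  have hs : s < 0 := hst.trans ht
  have hts : 0 < t - s := sub_pos.2 hst
  -- measurability of `W` on the window `(s, t) × E`
  have hmeas : AEStronglyMeasurable (uncurry W)
      ((volume : Measure (ℝ × E)).restrict (Ioo s t ×ˢ univ)) := by
    refine (hcont.mono ?_).aestronglyMeasurable (measurableSet_Ioo.prod MeasurableSet.univ)
    exact prod_mono (fun τ hτ => hτ.2.trans ht) subset_rfl
  have hφc : Continuous φ := hφ.contDiff.continuous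
  have hφi : Integrable φ := hφc.integrable_of_hasCompactSupport hφ.hasCompactSupport
  have hKτ : ∀ τ ∈ Ioo s t, ∀ y, ‖W τ y‖ ≤ K := fun τ hτ y => hK τ (hτ.2.trans ht) y
  -- the two pairings of the representation formula
  have h1 : Integrable (fun x => ⟪UnboundedOperators.heatExtension (W s) (ν * (t - s)) x, φ x⟫) :=
    integrable_inner_of_aestronglyMeasurable_of_norm_le
      ((UnboundedOperators.contDiff_heatExtension_of_bound (m := 0) (hWc s hs)
        (fun z => hK s hs z) (mul_pos hν hts)).continuous.aestronglyMeasurable)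
      (fun x => UnboundedOperators.norm_heatExtension_le_of_bound (fun z => hK s hs z)
        (mul_pos hν hts) x) hφi
  have h2 : Integrable (fun x => ⟪oseenDuhamel ν s W W t x, φ x⟫) := by
    obtain ⟨C, hC, hB⟩ := exists_norm_oseenDuhamel_bounded_le (E := E)
    exact integrable_inner_of_aestronglyMeasurable_of_norm_le
      (aestronglyMeasurable_oseenDuhamel hν hmeas hmeas hK0 hKτ hKτ hst le_rfl)
      (fun x => hB hν hst hK0 hKτ hKτ x) hφi
  -- assemble
  have hlhs : (fun x => ⟪W t x, φ x⟫) = fun x =>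
      ⟪UnboundedOperators.heatExtension (W s) (ν * (t - s)) x, φ x⟫ -
        ⟪oseenDuhamel ν s W W t x, φ x⟫ := by
    funext x
    rw [hmild s t hst ht x, inner_sub_left]
  rw [hlhs, integral_sub h1 h2,
    integral_inner_heatExtension_comm_of_bound (hWc s hs).aestronglyMeasurable
      (fun z => hK s hs z) hφc hφ.hasCompactSupport (mul_pos hν hts),
    integral_inner_oseenDuhamel_eq_neg_intervalIntegral hν hmeas hK0 hKτ hst le_rfl hφ hφdiv,
    heatTest_of_pos hν hts]
  simp

/-- **An Oseen-mild bounded continuous ancient field is a bounded weak solution** on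
`ℝⁿ × (−∞, 0)` in KNSS's sense (KNSS 2009, §4 (i)–(ii), arXiv p. 8: mild solutions are weak
solutions; here through `isBoundedAncientMildSolution_of_oseen` and the tree's
`IsBoundedAncientMildSolution.isBoundedWeakNSSolutionOn`, continuity supplying the
measurability). [cite: KochNadirashviliSereginSverak2009, §4 (i)–(ii) (arXiv p. 8)] -/
theorem isBoundedWeakNSSolutionOn_of_oseen {ν : ℝ} (hν : 0 < ν) {W : ℝ → E → E}
    (hcont : ContinuousOn (uncurry W) (Iio 0 ×ˢ univ))
    (hbdd : ∃ K : ℝ, ∀ t < 0, ∀ x, ‖W t x‖ ≤ K)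
    (hdiv : ∀ t < 0, IsWeaklyDivFree (W t))
    (hmild : ∀ s t : ℝ, s < t → t < 0 → ∀ x,
      W t x = UnboundedOperators.heatExtension (W s) (ν * (t - s)) x - oseenDuhamel ν s W W t x) :
    IsBoundedWeakNSSolutionOn (Iio 0) isOpen_Iio ν W := by
  have hWc : ∀ τ < 0, Continuous (W τ) := fun τ hτ =>
    hcont.comp_continuous (f := fun x : E => (τ, x)) (by fun_prop) fun x => ⟨hτ, mem_univ _⟩
  exact (isBoundedAncientMildSolution_of_oseen hν hcont hbdd hdiv hmild).isBoundedWeakNSSolutionOn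
    hν (hcont.aestronglyMeasurable (measurableSet_Iio.prod MeasurableSet.univ))
    fun t ht => (hWc t ht).aestronglyMeasurable

end Mild

/-! ### Remark 6.1 for a field whose planar part is constant in space -/

section R3

/- In this section `ℝ³ = EuclideanSpace ℝ (Fin 3)`, `ℝ² = EuclideanSpace ℝ (Fin 2)`, the
ignorable coordinate is the Lean index `1` (KNSS's `x₂`) with unit vector
`e₁ = EuclideanSpace.single 1 1`, and the planar components are the Lean indices `0, 2`. -/

/-- **The planar components of the inner integral of the Duhamel term of `β + W₁e₁` vanish.**
Let `σ > 0` and let `w : ℝ³ → ℝ³` be continuous, bounded, invariant under `y ↦ y + δe₁`, with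
planar part constant in space (`w(y)₀ = w(0)₀`, `w(y)₂ = w(0)₂`). Then for `m ≠ 1`,
`⟪∫ K(σ, x − y)[w(y), w(y)] dy, e_m⟫ = 0`: writing `w = β + g e₁`,
`∫ K[β, β] dy = 0` (`integral_oseenKernel_sub_left_eq_zero`), the planar part of
`∫ K[β, g e₁] dy` vanishes (`inner_integral_oseenKernel_sub_smul_single_right`) and
`∫ K[g e₁, w] dy = 0` (`integral_oseenKernel_sub_smul_single_left`). [folklore] -/
theorem inner_integral_oseenKernel_sub_eq_zero_of_planar_const {σ : ℝ} (hσ : 0 < σ)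
    {w : EuclideanSpace ℝ (Fin 3) → EuclideanSpace ℝ (Fin 3)} (hwc : Continuous w)
    {K : ℝ} (hK : ∀ y, ‖w y‖ ≤ K)
    (hinv : ∀ (y : EuclideanSpace ℝ (Fin 3)) (δ : ℝ), w (y + EuclideanSpace.single 1 δ) = w y)
    (hpl : ∀ y, w y 0 = w 0 0 ∧ w y 2 = w 0 2) (x : EuclideanSpace ℝ (Fin 3))
    {m : Fin 3} (hm : m ≠ 1) :
    ⟪∫ y, oseenKernel σ (x - y) (w y) (w y), EuclideanSpace.single m (1 : ℝ)⟫ = 0 := by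
  -- the decomposition `w = β + g e₁`
  set β : EuclideanSpace ℝ (Fin 3) :=
    w 0 0 • EuclideanSpace.single 0 (1 : ℝ) + w 0 2 • EuclideanSpace.single 2 (1 : ℝ) with hβ
  have hdec : ∀ y, w y = β + w y 1 • EuclideanSpace.single (1 : Fin 3) (1 : ℝ) := by
    intro y
    obtain ⟨h0, h2⟩ := hpl y
    ext j
    fin_cases j <;> simp [hβ, h0, h2]
  have hgc : Continuous fun y => w y 1 := (PiLp.continuous_apply 2 _ 1).comp hwc
  have hgb : ∀ y, |w y 1| ≤ K := fun y =>
    (Real.norm_eq_abs _ ▸ PiLp.norm_apply_le (w y) 1).trans (hK y)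
  have hgi : ∀ (y : EuclideanSpace ℝ (Fin 3)) (δ : ℝ),
      w (y + EuclideanSpace.single 1 δ) 1 = w y 1 := fun y δ => by rw [hinv y δ]
  have hge : Continuous fun y : EuclideanSpace ℝ (Fin 3) =>
      w y 1 • EuclideanSpace.single (1 : Fin 3) (1 : ℝ) := hgc.smul continuous_const
  have hgeb : ∀ y, ‖w y 1 • EuclideanSpace.single (1 : Fin 3) (1 : ℝ)‖ ≤ K := fun y => by
    rw [norm_smul, norm_single_one_one, mul_one]; exact hgb y
  -- split the integrand
  have hsplit : ∀ y, oseenKernel σ (x - y) (w y) (w y) =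
      oseenKernel σ (x - y) β β +
        oseenKernel σ (x - y) β (w y 1 • EuclideanSpace.single (1 : Fin 3) (1 : ℝ)) +
        oseenKernel σ (x - y) (w y 1 • EuclideanSpace.single (1 : Fin 3) (1 : ℝ)) (w y) := by
    intro y
    conv_lhs => rw [hdec y]
    rw [oseenKernel_add_left, oseenKernel_add_right, ← hdec y]
  have i1 : Integrable fun y : EuclideanSpace ℝ (Fin 3) => oseenKernel σ (x - y) β β :=
    integrable_oseenKernel_sub_of_bounded hσ (a := fun _ => β) (b := fun _ => β)
      aestronglyMeasurable_const aestronglyMeasurable_const (fun _ => le_rfl) (fun _ => le_rfl) x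
  have i2 : Integrable fun y : EuclideanSpace ℝ (Fin 3) =>
      oseenKernel σ (x - y) β (w y 1 • EuclideanSpace.single (1 : Fin 3) (1 : ℝ)) :=
    integrable_oseenKernel_sub_of_bounded hσ (a := fun _ => β)
      (b := fun y => w y 1 • EuclideanSpace.single (1 : Fin 3) (1 : ℝ)) aestronglyMeasurable_const
      hge.aestronglyMeasurable (fun _ => le_rfl) hgeb x
  have i3 : Integrable fun y : EuclideanSpace ℝ (Fin 3) =>
      oseenKernel σ (x - y) (w y 1 • EuclideanSpace.single (1 : Fin 3) (1 : ℝ)) (w y) :=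
    integrable_oseenKernel_sub_of_bounded hσ
      (a := fun y => w y 1 • EuclideanSpace.single (1 : Fin 3) (1 : ℝ)) (b := w)
      hge.aestronglyMeasurable hwc.aestronglyMeasurable hgeb hK x
  have i12 : Integrable fun y : EuclideanSpace ℝ (Fin 3) => oseenKernel σ (x - y) β β +
      oseenKernel σ (x - y) β (w y 1 • EuclideanSpace.single (1 : Fin 3) (1 : ℝ)) := i1.add i2
  have hv : ⟪(EuclideanSpace.single m (1 : ℝ) : EuclideanSpace ℝ (Fin 3)),
      EuclideanSpace.single (1 : Fin 3) (1 : ℝ)⟫ = 0 := by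
    rw [EuclideanSpace.inner_single_right]
    simp [hm]
  simp_rw [hsplit]
  rw [integral_add i12 i3, integral_add i1 i2, integral_oseenKernel_sub_left_eq_zero σ x β β,
    zero_add, inner_add_left,
    inner_integral_oseenKernel_sub_smul_single_right hσ (a := fun _ => β) (g := fun y => w y 1)
      aestronglyMeasurable_const hgc.aestronglyMeasurable (fun _ => le_rfl) hgb (fun _ _ => rfl)
      hgi x hv,
    integral_oseenKernel_sub_smul_single_left hσ (g := fun y => w y 1) (c := w)
      hgc.aestronglyMeasurable hwc.aestronglyMeasurable hgb hK hgi hinv x,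
    inner_zero_left, add_zero]

/-- A vector is zero if `√(−s)‖v‖ ≤ C` for all `s` below some `t ≤ 0` (let `s → −∞`; twin of
`eq_zero_of_forall_sqrt_neg_mul_norm_le` of `KNSSTypeIRateLiouville`, restated to keep this
file independent of it). [folklore] -/
theorem eq_zero_of_forall_lt_sqrt_neg_mul_norm_le {F : Type*} [NormedAddCommGroup F] {v : F}
    {t C : ℝ} (h : ∀ s < t, Real.sqrt (-s) * ‖v‖ ≤ C) (ht : t ≤ 0) : v = 0 := by
  by_contra hv
  have hn : 0 < ‖v‖ := norm_pos_iff.2 hv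
  set s : ℝ := t - (C / ‖v‖) ^ 2 - 1 with hs
  have hst : s < t := by rw [hs]; nlinarith [sq_nonneg (C / ‖v‖)]
  have hneg : (C / ‖v‖) ^ 2 < -s := by rw [hs]; linarith
  have h1 : |C| / ‖v‖ < Real.sqrt (-s) := by
    rw [← abs_of_pos hn, ← abs_div, ← Real.sqrt_sq_eq_abs]
    exact Real.sqrt_lt_sqrt (sq_nonneg _) hneg
  have h2 : |C| < Real.sqrt (-s) * ‖v‖ := by
    rw [div_lt_iff₀ hn] at h1
    exact h1
  linarith [h s hst, le_abs_self C]

/-- **Remark 6.1 for a field whose planar part is constant in space** (KNSS 2009, Remark 6.1,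
arXiv p. 11: "A bounded ancient mild solution … of the form `u(x, t) = b(t)` is constant";
here for the form the proof of Theorem 6.2, p. 13, needs it in). Let `W : ℝ → ℝ³ → ℝ³` be
jointly continuous and bounded on `(−∞, 0) × ℝ³`, satisfying the Oseen integral equation
pointwise for all `s < t < 0`, invariant under `x ↦ x + δe₁`, with `√(−t)‖W(t, x)‖ ≤ C`, and
suppose its planar part is constant in space: `W(t, x)₀ = W(t, 0)₀`, `W(t, x)₂ = W(t, 0)₂`.
Then the planar part vanishes. Proof: for `m ≠ 1` the `m`-th component of the representation
formula reads `W(t, x)ₘ = (e^{(t−s)Δ}W(s))ₘ(x) − (B¹_s(W, W)(t))ₘ(x) = W(s, 0)ₘ − 0`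
(`heatExtension_clm_comp_of_bound`, `heatExtension_const`;
`inner_integral_oseenKernel_sub_eq_zero_of_planar_const` inside the time integral), so
`√(−s)|W(t, x)ₘ| = √(−s)|W(s, 0)ₘ| ≤ C` for every `s < t`, and `s → −∞`. [cite: KochNadirashviliSereginSverak2009, Remark 6.1 (arXiv p. 11) and proof of Thm 6.2 (p. 13)] -/
theorem planar_eq_zero_of_planar_const {C : ℝ}
    {W : ℝ → EuclideanSpace ℝ (Fin 3) → EuclideanSpace ℝ (Fin 3)}
    (hcont : ContinuousOn (uncurry W) (Iio 0 ×ˢ univ))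
    (hbdd : ∃ K : ℝ, ∀ t < 0, ∀ x, ‖W t x‖ ≤ K)
    (hmild : ∀ s t : ℝ, s < t → t < 0 → ∀ x,
      W t x = UnboundedOperators.heatExtension (W s) (t - s) x - oseenDuhamel 1 s W W t x)
    (hinv : ∀ t < 0, ∀ (x : EuclideanSpace ℝ (Fin 3)) (δ : ℝ),
      W t (x + EuclideanSpace.single 1 δ) = W t x)
    (hdecay : ∀ t < 0, ∀ x, Real.sqrt (-t) * ‖W t x‖ ≤ C)
    (hpl : ∀ t < 0, ∀ x, W t x 0 = W t 0 0 ∧ W t x 2 = W t 0 2) :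
    ∀ t < 0, ∀ x, W t x 0 = 0 ∧ W t x 2 = 0 := by
  obtain ⟨K, hK⟩ := hbdd
  have hK0 : 0 ≤ K := (norm_nonneg _).trans (hK (-1) (by norm_num) 0)
  have hWc : ∀ τ < 0, Continuous (W τ) := fun τ hτ =>
    hcont.comp_continuous (f := fun x : EuclideanSpace ℝ (Fin 3) => (τ, x)) (by fun_prop)
      fun x => ⟨hτ, mem_univ _⟩
  -- the `m`-th component, `m ≠ 1`, of `W(t, x)` equals that of `W(s, 0)` for every `s < t`
  have key : ∀ {m : Fin 3}, m ≠ 1 → ∀ s t : ℝ, s < t → t < 0 → ∀ x, W t x m = W s 0 m := by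
    intro m hm s t hst ht x
    have hs : s < 0 := hst.trans ht
    have hts : 0 < t - s := sub_pos.2 hst
    set e : EuclideanSpace ℝ (Fin 3) := EuclideanSpace.single m (1 : ℝ) with he
    have hcomp : ∀ v : EuclideanSpace ℝ (Fin 3), ⟪e, v⟫ = v m := fun v => by
      rw [he, EuclideanSpace.inner_single_left]; simp
    -- the free term
    have hfree : ⟪e, UnboundedOperators.heatExtension (W s) (t - s) x⟫ = W s 0 m := by
      have h1 := UnboundedOperators.heatExtension_clm_comp_of_bound (innerSL ℝ e) (hWc s hs)
        (fun z => hK s hs z) hts x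
      simp only [innerSL_apply_apply] at h1
      rw [← h1]
      have h2 : (fun z => ⟪e, W s z⟫) = fun _ => W s 0 m := by
        funext z
        rw [hcomp]
        rcases (show m = 0 ∨ m = 2 by fin_cases m <;> simp_all) with rfl | rfl
        · exact (hpl s hs z).1
        · exact (hpl s hs z).2
      rw [h2, UnboundedOperators.heatExtension_const _ hts]
    -- the Duhamel term
    have hduh : ⟪e, oseenDuhamel 1 s W W t x⟫ = 0 := by
      have hmeas : AEStronglyMeasurable (uncurry W)
          ((volume : Measure (ℝ × EuclideanSpace ℝ (Fin 3))).restrict (Ioo s t ×ˢ univ)) := by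
        refine (hcont.mono ?_).aestronglyMeasurable (measurableSet_Ioo.prod MeasurableSet.univ)
        exact prod_mono (fun τ hτ => hτ.2.trans ht) subset_rfl
      have hKτ : ∀ τ ∈ Ioo s t, ∀ y, ‖W τ y‖ ≤ K := fun τ hτ y => hK τ (hτ.2.trans ht) y
      have hint := integrable_oseenKernel_duhamel_bounded one_pos hmeas hmeas hK0 hKτ hKτ hst
        le_rfl x
      rw [volume_restrict_prod_univ_eq_prod] at hint
      have hF : Integrable (fun τ => ∫ y, oseenKernel (1 * (t - τ)) (x - y) (W τ y) (W τ y))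
          (volume.restrict (Ioo s t)) := hint.integral_prod_left
      rw [oseenDuhamel_apply, ← integral_inner hF e]
      refine setIntegral_eq_zero_of_forall_eq_zero fun τ hτ => ?_
      have hτ0 : τ < 0 := hτ.2.trans ht
      have hσ : 0 < 1 * (t - τ) := by rw [one_mul]; exact sub_pos.2 hτ.2
      rw [real_inner_comm]
      exact inner_integral_oseenKernel_sub_eq_zero_of_planar_const hσ (hWc τ hτ0)
        (fun y => hK τ hτ0 y) (fun y δ => hinv τ hτ0 y δ) (fun y => hpl τ hτ0 y) x hm
    rw [← hcomp, hmild s t hst ht x, inner_sub_right, hfree, hduh, sub_zero]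
  -- let `s → −∞`
  have hzero : ∀ {m : Fin 3}, m ≠ 1 → ∀ t < 0, ∀ x, W t x m = 0 := by
    intro m hm t ht x
    refine eq_zero_of_forall_lt_sqrt_neg_mul_norm_le (t := t) (C := C) (fun s hst => ?_) ht.le
    have hs : s < 0 := hst.trans ht
    rw [key hm s t hst ht x, Real.norm_eq_abs]
    calc Real.sqrt (-s) * |W s 0 m| ≤ Real.sqrt (-s) * ‖W s 0‖ := by
          gcongr
          exact Real.norm_eq_abs _ ▸ PiLp.norm_apply_le (W s 0) m
      _ ≤ C := hdecay s hs 0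
  intro t ht x
  exact ⟨hzero (by decide) t ht x, hzero (by decide) t ht x⟩

/-! ### From Theorem 5.1 on the plane to the planar half -/

/-- **The planar part is constant in space once its trace on the plane `x₁ = 0` is a.e.
constant for a.e. time.** Let `W : ℝ → ℝ³ → ℝ³` be jointly continuous on `(−∞, 0) × ℝ³` and
invariant under `x ↦ x + δe₁`, and suppose that for a.e. `t < 0` the planar trace
`V(t, y) = (W(t, (y₀, 0, y₁))₀, W(t, (y₀, 0, y₁))₂)` is a.e. equal to a constant `b(t)` (the
conclusion of KNSS Theorem 5.1 for `V`). Then `W(t, x)₀ = W(t, 0)₀` and `W(t, x)₂ = W(t, 0)₂`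
for *every* `t < 0` and `x`: a continuous slice a.e. equal to a constant is constant
(`Measure.eq_of_ae_eq`), the identity `V(t, y) = V(t, 0)` between functions continuous on
`(−∞, 0)` holds a.e. hence everywhere (`Measure.eqOn_open_of_ae_eq`), and
`W(t, x) = W(t, (x₀, 0, x₂))`. [folklore] -/
theorem planar_const_of_ae_const {W : ℝ → EuclideanSpace ℝ (Fin 3) → EuclideanSpace ℝ (Fin 3)}
    (hcont : ContinuousOn (uncurry W) (Iio 0 ×ˢ univ))
    (hinv : ∀ t < 0, ∀ (x : EuclideanSpace ℝ (Fin 3)) (δ : ℝ),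
      W t (x + EuclideanSpace.single 1 δ) = W t x)
    {b : ℝ → EuclideanSpace ℝ (Fin 2)}
    (hae : ∀ᵐ t ∂((volume : Measure ℝ).restrict (Iio 0)),
      (fun y : EuclideanSpace ℝ (Fin 2) =>
        (toLp 2 ![W t (toLp 2 ![y 0, 0, y 1]) 0, W t (toLp 2 ![y 0, 0, y 1]) 2] :
          EuclideanSpace ℝ (Fin 2))) =ᵐ[volume] fun _ => b t) :
    ∀ t < 0, ∀ x, W t x 0 = W t 0 0 ∧ W t x 2 = W t 0 2 := by
  set L : EuclideanSpace ℝ (Fin 2) → EuclideanSpace ℝ (Fin 3) := fun y => toLp 2 ![y 0, 0, y 1]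
    with hL
  set V : ℝ → EuclideanSpace ℝ (Fin 2) → EuclideanSpace ℝ (Fin 2) :=
    fun t y => toLp 2 ![W t (L y) 0, W t (L y) 2] with hV
  have hLc : Continuous L := by
    rw [hL]
    refine (PiLp.continuous_toLp 2 _).comp (continuous_pi fun i => ?_)
    fin_cases i
    · exact PiLp.continuous_apply 2 _ 0
    · exact continuous_const
    · exact PiLp.continuous_apply 2 _ 1
  have hL0 : L 0 = 0 := by
    rw [hL]; ext j; fin_cases j <;> simp
  have hWc : ∀ τ < 0, Continuous (W τ) := fun τ hτ =>
    hcont.comp_continuous (f := fun x : EuclideanSpace ℝ (Fin 3) => (τ, x)) (by fun_prop)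
      fun x => ⟨hτ, mem_univ _⟩
  have hplanar : Continuous fun v : EuclideanSpace ℝ (Fin 3) =>
      (toLp 2 ![v 0, v 2] : EuclideanSpace ℝ (Fin 2)) := by
    refine (PiLp.continuous_toLp 2 _).comp (continuous_pi fun i => ?_)
    fin_cases i
    · exact PiLp.continuous_apply 2 _ 0
    · exact PiLp.continuous_apply 2 _ 2
  have hVc : ∀ t < 0, Continuous (V t) := fun t ht => hplanar.comp ((hWc t ht).comp hLc)
  have hVt : ∀ y, ContinuousOn (fun t => V t y) (Iio 0) := by
    intro y
    have h1 : ContinuousOn (fun t : ℝ => W t (L y)) (Iio 0) :=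
      hcont.comp (f := fun t : ℝ => (t, L y)) (by fun_prop) fun t ht => ⟨ht, mem_univ _⟩
    exact hplanar.comp_continuousOn h1
  -- every slice of `V` is constant
  have hconst : ∀ t < 0, ∀ y, V t y = V t 0 := by
    intro t₀ ht₀ y
    have hfy : (fun t => V t y - V t 0) =ᵐ[(volume : Measure ℝ).restrict (Iio 0)]
        fun _ => (0 : EuclideanSpace ℝ (Fin 2)) := by
      filter_upwards [hae, ae_restrict_mem measurableSet_Iio] with t ht ht0
      have heq : V t = fun _ => b t := Measure.eq_of_ae_eq ht (hVc t ht0) continuous_const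
      simp only [heq, sub_self]
    have h := Measure.eqOn_open_of_ae_eq hfy isOpen_Iio ((hVt y).sub (hVt 0)) continuousOn_const
      ht₀
    exact sub_eq_zero.1 h
  -- read off the components
  intro t ht x
  have hx : x = L (toLp 2 ![x 0, x 2]) + EuclideanSpace.single 1 (x 1) := by
    rw [hL]; ext j; fin_cases j <;> simp
  have hWx : W t x = W t (L (toLp 2 ![x 0, x 2])) := by
    conv_lhs => rw [hx]
    rw [hinv t ht]
  have hc := hconst t ht (toLp 2 ![x 0, x 2])
  rw [hV] at hc
  simp only [hL0] at hc
  have h0 := congrArg (fun v : EuclideanSpace ℝ (Fin 2) => v 0) hc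
  have h2 := congrArg (fun v : EuclideanSpace ℝ (Fin 2) => v 1) hc
  simp only [Matrix.cons_val_zero, Matrix.cons_val_one] at h0 h2
  rw [hWx]
  exact ⟨h0, h2⟩

/-- **The planar half of the Liouville step of KNSS Theorem 6.2 from Theorem 5.1 as printed,
given the descent to the plane.** Assume KNSS Theorem 5.1 (`KNSS2009_liouville_planar`: a
bounded weak solution on `ℝ² × (−∞, 0)` is `b(t)` a.e. for a.e. `t`). Let `W : ℝ → ℝ³ → ℝ³` be
jointly continuous and bounded on `(−∞, 0) × ℝ³`, satisfying the Oseen integral equation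
pointwise for all `s < t < 0`, invariant under `x ↦ x + δe₁`, with `√(−t)‖W(t, x)‖ ≤ C`, and
suppose its planar trace `V(t, y) = (W₀, W₂)(t, (y₀, 0, y₁))` is a bounded weak solution on
`ℝ² × (−∞, 0)`. Then `W₀ = W₂ = 0` on `(−∞, 0) × ℝ³` (Theorem 5.1 for `V`, then
`planar_const_of_ae_const` and `planar_eq_zero_of_planar_const` = Remark 6.1 and the decay).
The hypothesis on `V` is discharged in `KNSSTypeIRateLiouvilleDescent`. [cite: KochNadirashviliSereginSverak2009, proof of Thm 6.2 (arXiv p. 13) with Thm 5.1 (p. 9) and Remark 6.1 (p. 11)] -/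
theorem KNSS2009_typeI_rate_liouville_horizontal_of_weak_planar (h51 : KNSS2009_liouville_planar)
    {C : ℝ} {W : ℝ → EuclideanSpace ℝ (Fin 3) → EuclideanSpace ℝ (Fin 3)}
    (hcont : ContinuousOn (uncurry W) (Iio 0 ×ˢ univ))
    (hbdd : ∃ K : ℝ, ∀ t < 0, ∀ x, ‖W t x‖ ≤ K)
    (hmild : ∀ s t : ℝ, s < t → t < 0 → ∀ x,
      W t x = UnboundedOperators.heatExtension (W s) (t - s) x - oseenDuhamel 1 s W W t x)
    (hinv : ∀ t < 0, ∀ (x : EuclideanSpace ℝ (Fin 3)) (δ : ℝ),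
      W t (x + EuclideanSpace.single 1 δ) = W t x)
    (hdecay : ∀ t < 0, ∀ x, Real.sqrt (-t) * ‖W t x‖ ≤ C)
    (hV : IsBoundedWeakNSSolutionOn (Iio 0) isOpen_Iio 1
      (fun t (y : EuclideanSpace ℝ (Fin 2)) =>
        (toLp 2 ![W t (toLp 2 ![y 0, 0, y 1]) 0, W t (toLp 2 ![y 0, 0, y 1]) 2] :
          EuclideanSpace ℝ (Fin 2)))) :
    ∀ t < 0, ∀ x, W t x 0 = 0 ∧ W t x 2 = 0 := by
  obtain ⟨b, -, -, hae⟩ := h51 hV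
  exact planar_eq_zero_of_planar_const hcont hbdd hmild hinv hdecay
    (planar_const_of_ae_const hcont hinv hae)

end R3

end Literature.Analysis.FluidPDE

end
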